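import Literature.Geometry.Riemannian.SphericalCylinderEntropy
import Literature.Geometry.Manifold.CylinderSlice
import Literature.MeasureTheory.Hausdorff.SphereAreaGeneral
import Mathlib.MeasureTheory.Measure.Haar.InnerProductSpace
import Mathlib.Analysis.SpecialFunctions.Gamma.Basic
import Mathlib.Analysis.Real.Pi.Bounds
import HarnessLib

/-!
# A fat cross-section of the round cylinder: the tilted slice `x ↦ (x, A x₀)` of `S⁴` inside `S⁴ × ℝ`

Topic `Literature/Geometry/Riemannian` (companion of `CylinderSlice.lean` / `SphericalCylinderEntropy.lean`; written by the standing
disprover of crux `ThinCrossSectionExists` of route `SmoothPoincare4/CylinderEntropy`, whose items quantify over smooth end-separating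
cross-section embeddings `ι : M → ℝ⁶` into `N = {∑_{i<5} zᵢ² = 1}` with typed cylinder entropy `λ_cyl(range ι)` below a threshold).

The slices `S⁴ × {c}` are the thin cross-sections (`λ_cyl = 1` given the calibration).  This file provides the FAT one, proving that
thinness is a property of a representative, not of the sphere or of its isotopy class:

* `tilt A : S⁴ → ℝ⁶`, `x ↦ (x, A x₀)` — lies in `N` (`sum_sq_tilt`), **is a `C^∞` embedding** (`isSmoothEmbedding_tilt`, tree immersion
  criterion after `mfderiv_coe_sphere_injective`, exactly as for `sliceMap`), and **separates the two ends** in the typed `JoinedIn`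
  sense (`separates_range_tilt`: intermediate value theorem for `z₅ - A z₀` along a path);
* `box_subset_image` — its shadow under the 1-Lipschitz coordinate projection `z ↦ (z₅, z₁, z₂, z₃)` contains the long box
  `[-A/2, A/2] × [-1/4, 1/4]³` (`A ≥ 1`), of volume `A/8` (`volume_box`, `euclideanHausdorff_box`);
* `euclideanHausdorff_sphere_four` — `μHE[4](S⁴) = 8π²/3` (from the tree's `euclideanHausdorffMeasure_unitSphere_general`);
  `ratio_eq` — `μH[4]`-ratios are `μHE[4]`-ratios;
* `two_le_cylEntropy_tilt` — **`λ_cyl(range (tilt 1000)) ≥ 2`** (entropy `≥` area ratio, `measure_ratio_le_cylEntropy`), above every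
  threshold of the route (`4/e < 2`).

Everything is proved; no facts and no `Prop`-valued definitions.

## References
* H. Federer, *Geometric Measure Theory* (1969), 2.10.11 (Lipschitz maps and Hausdorff measure), 3.2.13 (area of spheres).
-/

noncomputable section

open scoped Manifold ContDiff Topology ENNReal NNReal MeasureTheory
open Set Function Filter _root_.MeasureTheory
open Literature.Geometry.Manifold.CylinderSlice (padL axis padL_apply_castSucc padL_apply_last padL_injective
  castSucc_ne_five sum_sq_eq_one)
open Literature.Geometry.Riemannian.SphericalCylinderEntropy (cylEntropy measure_ratio_le_cylEntropy
  hausdorffMeasure_sphere_four_pos hausdorffMeasure_sphere_four_lt_top)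

namespace Literature.Geometry.Riemannian.TiltedSliceEntropy

local notation "E⁶" => EuclideanSpace ℝ (Fin 6)
local notation "E⁵" => EuclideanSpace ℝ (Fin 5)
local notation "E⁴" => EuclideanSpace ℝ (Fin 4)
local notation "𝕊⁴" => (Metric.sphere (0 : EuclideanSpace ℝ (Fin 5)) 1)
/-- The linear map `y ↦ (y, A·y₀)`: `ℝ⁵ → ℝ⁶`. [folklore] -/
def G (A : ℝ) : E⁵ →L[ℝ] E⁶ := padL + (A • EuclideanSpace.proj (0 : Fin 5)).smulRight axis

/-- The first five coordinates of `G A y` are those of `y`. [folklore] -/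
@[simp] lemma G_apply_castSucc (A : ℝ) (y : E⁵) (i : Fin 5) : G A y (Fin.castSucc i) = y i := by
  simp [G, axis, castSucc_ne_five i]

/-- The height of `G A y` is `A y₀`. [folklore] -/
@[simp] lemma G_apply_five (A : ℝ) (y : E⁵) : G A y 5 = A * y 0 := by
  simp [G, axis]

/-- `G A` is injective (read off the first five coordinates). [folklore] -/
lemma G_injective (A : ℝ) : Injective (G A) := by
  intro y y' h
  ext i
  simpa using congrArg (fun z : E⁶ => z (Fin.castSucc i)) h

/-- The tilted slice `x ↦ (x, A x₀)` of `S⁴` inside `N`. [folklore] -/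
def tilt (A : ℝ) (x : 𝕊⁴) : E⁶ := G A (x : E⁵)

/-- `tilt A` is the linear map `G A` after the sphere inclusion. [folklore] -/
lemma tilt_eq_comp (A : ℝ) : tilt A = (G A : E⁵ → E⁶) ∘ Subtype.val := rfl

/-- The tilted slice lies in the cylinder `N = {∑_{i<5} zᵢ² = 1}`. [folklore] -/
lemma sum_sq_tilt (A : ℝ) (x : 𝕊⁴) : ∑ i : Fin 5, tilt A x (Fin.castSucc i) ^ 2 = 1 := by
  simp only [tilt, G_apply_castSucc]; exact sum_sq_eq_one x

/-- **The tilted slice is a smooth embedding** (tree immersion criterion, as for `sliceMap`). [folklore] -/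
theorem isSmoothEmbedding_tilt (A : ℝ) : Manifold.IsSmoothEmbedding (𝓡 4) (𝓡 6) ∞ (tilt A) := by
  haveI : Fact (Module.finrank ℝ E⁵ = 4 + 1) := ⟨finrank_euclideanSpace_fin⟩
  have hval : ContMDiff (𝓡 4) 𝓘(ℝ, E⁵) ∞ (Subtype.val : 𝕊⁴ → E⁵) := contMDiff_coe_sphere
  have hf : ContMDiff (𝓡 4) (𝓡 6) ∞ (tilt A) := (G A).contDiff.comp_contMDiff hval
  refine Literature.Topology.FourManifolds.isSmoothEmbedding_of_injective_of_injective_mfderiv hf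
    (by norm_num) ?_ ?_
  · exact (G_injective A).comp Subtype.val_injective
  · intro x
    have h1 : HasMFDerivAt (𝓡 4) 𝓘(ℝ, E⁵) (Subtype.val : 𝕊⁴ → E⁵) x
        (mfderiv (𝓡 4) 𝓘(ℝ, E⁵) (Subtype.val : 𝕊⁴ → E⁵) x) :=
      ((hval x).mdifferentiableAt (by simp)).hasMFDerivAt
    have h3 := (G A).hasFDerivAt.hasMFDerivAt.comp x h1
    rw [tilt_eq_comp, h3.mfderiv]
    exact (G_injective A).comp (mfderiv_coe_sphere_injective x)

/-- A point of `N` on the hyperplane `z₅ = A z₀` is on the tilted slice. [folklore] -/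
lemma mem_range_tilt {A : ℝ} {z : E⁶} (hz : ∑ i : Fin 5, z (Fin.castSucc i) ^ 2 = 1) (h5 : z 5 = A * z 0) :
    z ∈ Set.range (tilt A) := by
  let y : E⁵ := WithLp.toLp 2 fun i => z (Fin.castSucc i)
  have hy : ∀ i, y i = z (Fin.castSucc i) := fun i => rfl
  have hnorm : ‖y‖ = 1 := by
    rw [EuclideanSpace.norm_eq, Real.sqrt_eq_one]
    simpa [hy, Real.norm_eq_abs, sq_abs] using hz
  refine ⟨⟨y, by simpa using hnorm⟩, ?_⟩
  ext j
  induction j using Fin.lastCases with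
  | last =>
    rw [show (Fin.last 5 : Fin 6) = 5 from rfl, tilt, G_apply_five, h5]
    rfl
  | cast i => rw [tilt, G_apply_castSucc]

/-- `|y₀| ≤ 1` on `S⁴`. [folklore] -/
lemma abs_apply_zero_le_sphere {y : E⁵} (hy : ∑ i : Fin 5, y i ^ 2 = 1) : |y 0| ≤ 1 := by
  have : y 0 ^ 2 ≤ ∑ i : Fin 5, y i ^ 2 :=
    Finset.single_le_sum (f := fun i => y i ^ 2) (fun i _ => sq_nonneg _) (Finset.mem_univ 0)
  rw [hy] at this
  exact (sq_le_one_iff_abs_le_one _).mp this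

/-- `|z₀| ≤ 1` on `N`. [folklore] -/
lemma abs_apply_zero_le {z : E⁶} (hz : ∑ i : Fin 5, z (Fin.castSucc i) ^ 2 = 1) : |z 0| ≤ 1 := by
  have : z (Fin.castSucc 0) ^ 2 ≤ ∑ i : Fin 5, z (Fin.castSucc i) ^ 2 :=
    Finset.single_le_sum (f := fun i => z (Fin.castSucc i) ^ 2) (fun i _ => sq_nonneg _) (Finset.mem_univ 0)
  rw [hz] at this
  exact (sq_le_one_iff_abs_le_one _).mp this

/-- **The tilted slice separates the ends** (IVT on `z₅ - A z₀` along a path). [folklore] -/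
theorem separates_range_tilt (A : ℝ) :
    ∃ R : ℝ, ∀ a b : E⁶, ∑ i : Fin 5, a (Fin.castSucc i) ^ 2 = 1 →
      ∑ i : Fin 5, b (Fin.castSucc i) ^ 2 = 1 → a 5 ≤ -R → R ≤ b 5 →
        ¬ JoinedIn ({z : E⁶ | ∑ i : Fin 5, z (Fin.castSucc i) ^ 2 = 1} \ Set.range (tilt A)) a b := by
  refine ⟨|A| + 1, fun a b ha hb hac hcb hj => ?_⟩
  obtain ⟨γ, hγ⟩ := hj
  set g : ℝ → ℝ := fun s => (γ.extend s) 5 - A * (γ.extend s) 0 with hg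
  have hgc : Continuous g := by
    have h5 := (EuclideanSpace.proj (5 : Fin 6)).continuous.comp γ.continuous_extend
    have h0 := (EuclideanSpace.proj (0 : Fin 6)).continuous.comp γ.continuous_extend
    exact h5.sub (h0.const_mul A)
  have h0 : g 0 = a 5 - A * a 0 := by simp [hg]
  have h1 : g 1 = b 5 - A * b 0 := by simp [hg]
  have hAa : |A * a 0| ≤ |A| := by rw [abs_mul]; exact mul_le_of_le_one_right (abs_nonneg A) (abs_apply_zero_le ha)
  have hAb : |A * b 0| ≤ |A| := by rw [abs_mul]; exact mul_le_of_le_one_right (abs_nonneg A) (abs_apply_zero_le hb)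
  have hc : (0 : ℝ) ∈ Set.Icc (g 0) (g 1) := by
    rw [h0, h1]
    constructor <;> linarith [le_abs_self (A * a 0), neg_abs_le (A * a 0), le_abs_self (A * b 0), neg_abs_le (A * b 0)]
  obtain ⟨s, hs, hsc⟩ := intermediate_value_Icc zero_le_one hgc.continuousOn hc
  have hmem := hγ ⟨s, hs⟩
  rw [← Path.extend_extends' γ ⟨s, hs⟩] at hmem
  refine hmem.2 (mem_range_tilt hmem.1 ?_)
  have : g s = 0 := hsc
  simp only [hg] at this
  linarith

/-! ### The shadow: a 1-Lipschitz linear map onto `ℝ⁴` under which the tilted slice covers a long box -/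

/-- `z ↦ (z₅, z₁, z₂, z₃)`. [folklore] -/
def P : E⁶ →L[ℝ] E⁴ :=
  (EuclideanSpace.equiv (Fin 4) ℝ).symm.toContinuousLinearMap.comp
    (ContinuousLinearMap.pi fun j : Fin 4 =>
      EuclideanSpace.proj (if j = 0 then (5 : Fin 6) else Fin.castSucc (Fin.castSucc j)))

/-- Coordinates of the shadow map. [folklore] -/
lemma P_apply (z : E⁶) (j : Fin 4) :
    P z j = z (if j = 0 then (5 : Fin 6) else Fin.castSucc (Fin.castSucc j)) := by
  simp [P]

/-- The shadow map does not increase the norm. [folklore] -/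
lemma norm_P_le (z : E⁶) : ‖P z‖ ≤ ‖z‖ := by
  rw [EuclideanSpace.norm_eq, EuclideanSpace.norm_eq]
  refine Real.sqrt_le_sqrt ?_
  have e1 : (Fin.castSucc (Fin.castSucc (1 : Fin 4)) : Fin 6) = 1 := rfl
  have e2 : (Fin.castSucc (Fin.castSucc (2 : Fin 4)) : Fin 6) = 2 := rfl
  have e3 : (Fin.castSucc (Fin.castSucc (3 : Fin 4)) : Fin 6) = 3 := rfl
  have hsplit : ∑ j : Fin 4, ‖P z j‖ ^ 2 = ‖z 5‖ ^ 2 + (‖z 1‖ ^ 2 + ‖z 2‖ ^ 2 + ‖z 3‖ ^ 2) := by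
    simp only [P_apply, Fin.sum_univ_four, Fin.isValue, if_true, show (1 : Fin 4) ≠ 0 by decide,
      show (2 : Fin 4) ≠ 0 by decide, show (3 : Fin 4) ≠ 0 by decide, if_false, e1, e2, e3]
    ring
  have h6 : ∑ i : Fin 6, ‖z i‖ ^ 2 = ‖z 0‖ ^ 2 + ‖z 1‖ ^ 2 + ‖z 2‖ ^ 2 + ‖z 3‖ ^ 2 + ‖z 4‖ ^ 2 + ‖z 5‖ ^ 2 := by
    simp [Fin.sum_univ_succ]
    ring
  rw [hsplit, h6]
  nlinarith [sq_nonneg ‖z 0‖, sq_nonneg ‖z 4‖]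

/-- The shadow map is 1-Lipschitz. [folklore] -/
lemma lipschitz_P : LipschitzWith 1 P := by
  refine LipschitzWith.of_dist_le_mul fun x y => ?_
  rw [dist_eq_norm, dist_eq_norm, ← map_sub, NNReal.coe_one, one_mul]
  exact norm_P_le _

/-- The long box `[-A/2, A/2] × [-1/4, 1/4]³ ⊂ ℝ⁴` (as a preimage of a coordinate box). [folklore] -/
def boxI (A : ℝ) (j : Fin 4) : Set ℝ := if j = 0 then Set.Icc (-(A / 2)) (A / 2) else Set.Icc (-(1 / 4)) (1 / 4)

/-- The long box `[-A/2, A/2] × [-1/4, 1/4]³ ⊂ ℝ⁴`. [folklore] -/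
def box (A : ℝ) : Set E⁴ := (WithLp.ofLp : E⁴ → (Fin 4 → ℝ)) ⁻¹' Set.pi Set.univ (boxI A)

/-- Membership in the long box, coordinatewise. [folklore] -/
lemma mem_box {A : ℝ} {w : E⁴} : w ∈ box A ↔ ∀ j, w j ∈ boxI A j := by
  simp [box, Set.mem_pi]

/-- **The shadow of the tilted slice contains the long box** (for `A ≥ 1`): given `(t, w₁, w₂, w₃)` in the box,
the point `x = (t/A, w₁, w₂, w₃, √(1 - t²/A² - |w|²)) ∈ S⁴` tilts to a point with shadow `(t, w)`. [folklore] -/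
theorem box_subset_image {A : ℝ} (hA : 1 ≤ A) : box A ⊆ P '' Set.range (tilt A) := by
  intro w hw
  rw [mem_box] at hw
  have hw0 := hw 0; have hw1 := hw 1; have hw2 := hw 2; have hw3 := hw 3
  simp only [boxI, if_true, show (1 : Fin 4) ≠ 0 by decide, show (2 : Fin 4) ≠ 0 by decide,
    show (3 : Fin 4) ≠ 0 by decide, if_false, Set.mem_Icc] at hw0 hw1 hw2 hw3
  have hApos : 0 < A := by linarith
  set u : ℝ := w 0 / A with hu
  have hu' : |u| ≤ 1 / 2 := by
    rw [hu, abs_div, abs_of_pos hApos, div_le_iff₀ hApos, abs_le]; constructor <;> linarith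
  set r : ℝ := 1 - (u ^ 2 + w 1 ^ 2 + w 2 ^ 2 + w 3 ^ 2) with hr
  have hr0 : 0 ≤ r := by
    have := abs_le.mp hu'
    rw [hr]; nlinarith
  -- the point of S⁴
  let yf : Fin 5 → ℝ := ![u, w 1, w 2, w 3, Real.sqrt r]
  let y : E⁵ := WithLp.toLp 2 yf
  have hy : ∀ i, y i = yf i := fun i => rfl
  have hsum : ∑ i : Fin 5, y i ^ 2 = 1 := by
    simp only [hy, yf, Fin.sum_univ_five, Matrix.cons_val_zero, Matrix.cons_val_one, Matrix.cons_val]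
    rw [Real.sq_sqrt hr0, hr]; ring
  have hnorm : ‖y‖ = 1 := by
    rw [EuclideanSpace.norm_eq, Real.sqrt_eq_one]
    simpa [Real.norm_eq_abs, sq_abs] using hsum
  refine ⟨tilt A ⟨y, by simpa using hnorm⟩, ⟨_, rfl⟩, ?_⟩
  ext j
  rw [P_apply]
  fin_cases j
  · simp only [Fin.zero_eta, Fin.isValue, if_true]
    change tilt A ⟨y, _⟩ 5 = w 0
    rw [tilt, G_apply_five]
    change A * y 0 = w 0
    rw [hy]; simp only [yf, Matrix.cons_val_zero]; rw [hu]; field_simp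
  · change tilt A ⟨y, _⟩ (Fin.castSucc (Fin.castSucc 1)) = w 1
    rw [tilt, G_apply_castSucc]; rfl
  · change tilt A ⟨y, _⟩ (Fin.castSucc (Fin.castSucc 2)) = w 2
    rw [tilt, G_apply_castSucc]; rfl
  · change tilt A ⟨y, _⟩ (Fin.castSucc (Fin.castSucc 3)) = w 3
    rw [tilt, G_apply_castSucc]; rfl


/-! ### Measures: the box has volume `A/8`, the sphere has area `8π²/3`, and `μH`-ratios are `μHE`-ratios -/

/-- The coordinate box is measurable. [folklore] -/
lemma measurableSet_piBox (A : ℝ) : MeasurableSet (Set.pi Set.univ (boxI A)) :=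
  MeasurableSet.univ_pi fun j => by unfold boxI; split_ifs <;> exact measurableSet_Icc

/-- **The long box has volume `A · (1/2)³`** (product of side lengths, through Mathlib's `volume`-preserving `ofLp`). [folklore] -/
lemma volume_box (A : ℝ) : volume (box A) = ENNReal.ofReal A * ENNReal.ofReal (1 / 2) ^ 3 := by
  rw [box, (PiLp.volume_preserving_ofLp (Fin 4)).measure_preimage (measurableSet_piBox A).nullMeasurableSet,
    volume_pi_pi]
  simp only [boxI, Fin.prod_univ_four, Fin.isValue, if_true, show (1 : Fin 4) ≠ 0 by decide,
    show (2 : Fin 4) ≠ 0 by decide, show (3 : Fin 4) ≠ 0 by decide, if_false, Real.volume_Icc]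
  have h1 : A / 2 - -(A / 2) = A := by ring
  have h2 : (1 : ℝ) / 4 - -(1 / 4) = 1 / 2 := by ring
  rw [h1, h2]; ring

/-- `μHE[4]` on `ℝ⁴` is Lebesgue measure, so the box has `μHE[4] = A/8`. [folklore] -/
lemma euclideanHausdorff_box (A : ℝ) :
    (μHE[4] : Measure E⁴) (box A) = ENNReal.ofReal A * ENNReal.ofReal (1 / 2) ^ 3 := by
  have h := InnerProductSpace.euclideanHausdorffMeasure_eq_volume (V := E⁴)
  simp only [finrank_euclideanSpace_fin] at h
  rw [h, volume_box]

/-- **`|S⁴| = 8π²/3`** for the normalised Hausdorff measure (tree: the general sphere area, `Γ(5/2) = 3√π/4`). [folklore] -/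
lemma euclideanHausdorff_sphere_four :
    (μHE[4] : Measure E⁵) (Metric.sphere 0 1) = ENNReal.ofReal (8 * Real.pi ^ 2 / 3) := by
  rw [Literature.MeasureTheory.Hausdorff.euclideanHausdorffMeasure_unitSphere_general (E := E⁵) (d := 4)
    finrank_euclideanSpace_fin (by norm_num)]
  congr 1
  have hq : (((4 : ℕ) : ℝ) + 1) / 2 = 3 / 2 + 1 := by norm_num
  have hΓ : Real.Gamma ((((4 : ℕ) : ℝ) + 1) / 2) = 3 / 4 * Real.sqrt Real.pi := by
    rw [hq, Real.Gamma_add_one (by norm_num), show (3 : ℝ) / 2 = 1 / 2 + 1 by norm_num,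
      Real.Gamma_add_one (by norm_num), Real.Gamma_one_half_eq]
    ring
  have hpow : Real.pi ^ ((((4 : ℕ) : ℝ) + 1) / 2) = Real.pi ^ 2 * Real.sqrt Real.pi := by
    rw [show (((4 : ℕ) : ℝ) + 1) / 2 = (2 : ℝ) + 1 / 2 by norm_num, Real.rpow_add Real.pi_pos,
      Real.rpow_two, Real.sqrt_eq_rpow]
  rw [hΓ, hpow]
  have hs : 0 < Real.sqrt Real.pi := Real.sqrt_pos.mpr Real.pi_pos
  field_simp
  ring

/-- `μH[4]`-ratios equal `μHE[4]`-ratios (same normalising constant on every space). [folklore] -/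
lemma ratio_eq {X Y : Type*} [EMetricSpace X] [MeasurableSpace X] [BorelSpace X] [EMetricSpace Y]
    [MeasurableSpace Y] [BorelSpace Y] (s : Set X) (t : Set Y) :
    (μH[4] s)⁻¹ * μH[4] t = ((μHE[4] : Measure X) s)⁻¹ * (μHE[4] : Measure Y) t := by
  set c : ℝ≥0 := Measure.addHaarScalarFactor (volume : Measure (EuclideanSpace ℝ (Fin 4)))
    (μH[((4 : ℕ) : ℝ)] : Measure (EuclideanSpace ℝ (Fin 4))) with hc
  have hc0 : (c : ℝ≥0∞) ≠ 0 := by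
    rw [hc]; exact_mod_cast Measure.addHaarScalarFactor_volume_hausdorffMeasure_ne_zero 4
  have hct : (c : ℝ≥0∞) ≠ ⊤ := ENNReal.coe_ne_top
  have hX : (μHE[4] : Measure X) s = (c : ℝ≥0∞) * μH[4] s := by
    rw [Measure.euclideanHausdorffMeasure_def, Measure.smul_apply, ENNReal.smul_def, smul_eq_mul]
    rfl
  have hY : (μHE[4] : Measure Y) t = (c : ℝ≥0∞) * μH[4] t := by
    rw [Measure.euclideanHausdorffMeasure_def, Measure.smul_apply, ENNReal.smul_def, smul_eq_mul]
    rfl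
  rw [hX, hY, ENNReal.mul_inv (Or.inl hc0) (Or.inl hct)]
  calc (μH[4] s)⁻¹ * μH[4] t = (μH[4] s)⁻¹ * μH[4] t * ((c : ℝ≥0∞)⁻¹ * c) := by
        rw [ENNReal.inv_mul_cancel hc0 hct, mul_one]
    _ = (c : ℝ≥0∞)⁻¹ * (μH[4] s)⁻¹ * ((c : ℝ≥0∞) * μH[4] t) := by ring

/-! ### The fat cross-section -/

/-- The tilted slice has height `≤ |A|`. [folklore] -/
lemma height_tilt (A : ℝ) : ∀ z ∈ Set.range (tilt A), |z 5| ≤ |A| := by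
  rintro z ⟨x, rfl⟩
  rw [tilt, G_apply_five, abs_mul]
  exact mul_le_of_le_one_right (abs_nonneg A) (abs_apply_zero_le_sphere (sum_sq_eq_one x))

/-- **A FAT smooth cross-section of the standard sphere**: the tilted slice `x ↦ (x, 1000 x₀)` has typed
`λ_cyl ≥ 2 (> 4/e)`: entropy ≥ area ratio ≥ (shadow box volume `125`) / `|S⁴| = 8π²/3 < 27`. [folklore] -/
theorem two_le_cylEntropy_tilt : 2 ≤ cylEntropy (Set.range (tilt 1000)) := by
  have hcont : Continuous (tilt 1000) := (isSmoothEmbedding_tilt 1000).isEmbedding.continuous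
  have hmeas : MeasurableSet (Set.range (tilt 1000)) := (isCompact_range hcont).isClosed.measurableSet
  have hN : ∀ z ∈ Set.range (tilt 1000), ∑ i : Fin 5, z (Fin.castSucc i) ^ 2 = 1 := by
    rintro z ⟨x, rfl⟩; exact sum_sq_tilt 1000 x
  have h1 := measure_ratio_le_cylEntropy hmeas hN (height_tilt 1000)
  refine le_trans ?_ h1
  have h2 : μH[4] (box 1000) ≤ μH[4] (Set.range (tilt 1000)) :=
    calc μH[4] (box 1000) ≤ μH[4] (P '' Set.range (tilt 1000)) := measure_mono (box_subset_image (by norm_num))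
      _ ≤ (1 : ℝ≥0∞) ^ (4 : ℝ) * μH[4] (Set.range (tilt 1000)) := lipschitz_P.hausdorffMeasure_image_le (by norm_num) _
      _ = μH[4] (Set.range (tilt 1000)) := by simp
  calc (2 : ℝ≥0∞) ≤ (μH[4] (Metric.sphere (0 : E⁵) 1))⁻¹ * μH[4] (box 1000) := ?_
    _ ≤ (μH[4] (Metric.sphere (0 : E⁵) 1))⁻¹ * μH[4] (Set.range (tilt 1000)) := by gcongr
  rw [ratio_eq, euclideanHausdorff_sphere_four, euclideanHausdorff_box, ← ENNReal.ofReal_pow (by norm_num),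
    ← ENNReal.ofReal_mul (by norm_num), mul_comm, ← div_eq_mul_inv,
    ← ENNReal.ofReal_div_of_pos (by positivity), show (2 : ℝ≥0∞) = ENNReal.ofReal 2 by simp]
  apply ENNReal.ofReal_le_ofReal
  rw [le_div_iff₀ (by positivity)]
  have := Real.pi_lt_four
  nlinarith [Real.pi_pos]

end Literature.Geometry.Riemannian.TiltedSliceEntropy

end
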